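import Mathlib
import HarnessLib
import Summits.Ventures.LatticeQCDFlow.Exactness.LatticeCoordAvg

/-!
# The Efron–Stein inequality on a finite product of probability spaces: `Var(G) ≤ Σ_k E[Var_k(G)]`

HONEST FRAMING: exact (Metropolis-corrected) sampling algorithms for lattice gauge theory;
figures of merit are autocorrelation/cost numbers at stated couplings and volumes; no
continuum-physics claim.

Venture `LatticeQCDFlow` (cell pub-lqcd), topic `Exactness`; FANOUT row 7 (`s0-cpn-null`).  NEW
WORK of the cell over Mathlib and the tree's `Exactness/LatticeCoordAvg.lean` (coordinate
averages `A_s`: mean preservation, independence `A_{s∪{k}} = A_s ∘ A_k`, Jensen, orthogonality)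
and `Exactness/LatticeSiteResampling.lean`; nothing is cited as a fact.  Printed counterpart,
NAMED ONLY: the Efron–Stein (tensorisation of variance) inequality [folklore; B. Efron, C. Stein,
Ann. Statist. 9 (1981) 586]; it is the step that makes the spectral gap of Lüscher's operator
`−Σ_k ∂̃_k·∂̃_k` on a lattice of spheres INDEPENDENT OF THE LATTICE SIZE
(`Exactness/SphereLatticePoincare.lean`).

## Content (`ι` finite, `X` compact metric with a Borel probability measure `μ`, `π = ⊗_{i∈ι} μ`,
## `G : (ι → X) → ℝ` continuous, `A_s = coordAvg μ s`)

* **`integral_sq_sub_coordAvg_le`** — for every `s ⊆ ι`: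
  `E[(G − A_s G)²] ≤ Σ_{k∈s} E[(G − A_k G)²]` (induction on `s`: the increment
  `A_s G − A_{s∪{k}} G = A_s(G − A_k G)` is orthogonal to `G − A_s G` and, by Jensen, has second
  moment at most `E[(G − A_k G)²]`).
* **`efronStein`** — `Var_π(G) = E[(G − E G)²] ≤ Σ_k E[(G − A_k G)²]`.
* **`integral_sq_sub_coordAvg_singleton`** — `E[(G − A_k G)²] = E[Var_k G]`, the mean conditional
  variance in coordinate `k`: `∫ (∫ G(ω[k←v])² dμ(v) − (∫ G(ω[k←v]) dμ(v))²) dπ(ω)`.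

NOT CLAIMED: the `L²` (non-continuous) generality, infinite products, or any concentration
inequality built on Efron–Stein; anything about lattice models (that is `SphereLatticePoincare`).
-/

noncomputable section

namespace Summit.Ventures.LatticeQCDFlow.Exactness

open MeasureTheory Function
open scoped ENNReal

variable {ι : Type*} [Fintype ι] [DecidableEq ι]
variable {X : Type*} [MeasurableSpace X]

/-! ## The Efron–Stein inequality -/

section EfronStein

variable [MetricSpace X] [CompactSpace X] [BorelSpace X] (μ : Measure X) [IsProbabilityMeasure μ]

/-- **Efron–Stein, partial form**: for every `s ⊆ ι` and continuous `G`,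
`E[(G − A_s G)²] ≤ Σ_{k∈s} E[(G − A_k G)²]` (induction on `s`: the increment
`A_s G − A_{s∪{k}} G = A_s(G − A_k G)` is orthogonal to `G − A_s G` and, by Jensen, has second
moment at most `E[(G − A_k G)²]`). -/
theorem integral_sq_sub_coordAvg_le (s : Finset ι) {G : (ι → X) → ℝ} (hG : Continuous G) :
    ∫ ω, (G ω - coordAvg μ s G ω) ^ 2 ∂Measure.pi (fun _ : ι => μ) ≤
      ∑ k ∈ s, ∫ ω, (G ω - coordAvg μ {k} G ω) ^ 2 ∂Measure.pi (fun _ : ι => μ) := by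
  induction s using Finset.induction_on with
  | empty => simp [coordAvg_empty]
  | insert k s hk ih =>
    rw [Finset.sum_insert hk]
    have hA : Continuous (coordAvg μ s G) := continuous_coordAvg μ s hG
    have hAk : Continuous (coordAvg μ {k} G) := continuous_coordAvg μ {k} hG
    have hHk : Continuous fun ω => G ω - coordAvg μ {k} G ω := hG.sub hAk
    have hB : Continuous (coordAvg μ s fun ω => G ω - coordAvg μ {k} G ω) :=
      continuous_coordAvg μ s hHk
    -- the decomposition `G − A_{k∪s}G = (G − A_sG) + A_s(G − A_kG)`
    have hdec : ∀ ω, G ω - coordAvg μ (insert k s) G ω =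
        (G ω - coordAvg μ s G ω) + coordAvg μ s (fun ω => G ω - coordAvg μ {k} G ω) ω := by
      intro ω
      rw [coordAvg_insert μ hk hG, coordAvg_sub μ s hG hAk]
      ring
    simp_rw [hdec]
    have hi1 : Integrable (fun ω => (G ω - coordAvg μ s G ω) ^ 2) (Measure.pi fun _ : ι => μ) :=
      integrable_pi_of_continuous μ ((hG.sub hA).pow 2)
    have hi2 : Integrable (fun ω => (coordAvg μ s (fun ω => G ω - coordAvg μ {k} G ω) ω) ^ 2)
        (Measure.pi fun _ : ι => μ) := integrable_pi_of_continuous μ (hB.pow 2)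
    have hi12 : Integrable (fun ω => (G ω - coordAvg μ s G ω) ^ 2 +
        (coordAvg μ s (fun ω => G ω - coordAvg μ {k} G ω) ω) ^ 2) (Measure.pi fun _ : ι => μ) :=
      hi1.add hi2
    have hi3 : Integrable (fun ω => 2 * ((G ω - coordAvg μ s G ω) *
        coordAvg μ s (fun ω => G ω - coordAvg μ {k} G ω) ω)) (Measure.pi fun _ : ι => μ) :=
      (integrable_pi_of_continuous μ ((hG.sub hA).mul hB)).const_mul 2
    -- expand the square; the cross term vanishes
    have hcross : ∫ ω, (G ω - coordAvg μ s G ω) *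
        coordAvg μ s (fun ω => G ω - coordAvg μ {k} G ω) ω ∂Measure.pi (fun _ : ι => μ) = 0 :=
      integral_sub_coordAvg_mul_eq_zero μ s hG hB fun ω ω' => coordAvg_apply_piecewise μ s _ ω ω'
    have hsq : ∫ ω, ((G ω - coordAvg μ s G ω) +
        coordAvg μ s (fun ω => G ω - coordAvg μ {k} G ω) ω) ^ 2 ∂Measure.pi (fun _ : ι => μ) =
        ∫ ω, (G ω - coordAvg μ s G ω) ^ 2 ∂Measure.pi (fun _ : ι => μ) +
          ∫ ω, (coordAvg μ s (fun ω => G ω - coordAvg μ {k} G ω) ω) ^ 2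
            ∂Measure.pi (fun _ : ι => μ) := by
      have hfun : (fun ω => ((G ω - coordAvg μ s G ω) +
          coordAvg μ s (fun ω => G ω - coordAvg μ {k} G ω) ω) ^ 2) = fun ω =>
          ((G ω - coordAvg μ s G ω) ^ 2 +
            (coordAvg μ s (fun ω => G ω - coordAvg μ {k} G ω) ω) ^ 2) +
          2 * ((G ω - coordAvg μ s G ω) *
            coordAvg μ s (fun ω => G ω - coordAvg μ {k} G ω) ω) := by
        funext ω; ring
      rw [hfun, integral_add hi12 hi3, integral_add hi1 hi2, integral_const_mul, hcross, mul_zero,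
        add_zero]
    rw [hsq]
    -- Jensen on the second term, then `E[A_s ·] = E[·]`
    have hJ : ∫ ω, (coordAvg μ s (fun ω => G ω - coordAvg μ {k} G ω) ω) ^ 2
        ∂Measure.pi (fun _ : ι => μ) ≤
        ∫ ω, (G ω - coordAvg μ {k} G ω) ^ 2 ∂Measure.pi (fun _ : ι => μ) := by
      calc ∫ ω, (coordAvg μ s (fun ω => G ω - coordAvg μ {k} G ω) ω) ^ 2
            ∂Measure.pi (fun _ : ι => μ)
          ≤ ∫ ω, coordAvg μ s (fun ω => (G ω - coordAvg μ {k} G ω) ^ 2) ω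
              ∂Measure.pi (fun _ : ι => μ) :=
            integral_mono hi2 (integrable_pi_of_continuous μ
              (continuous_coordAvg μ s (hHk.pow 2))) fun ω => sq_coordAvg_le μ s hHk ω
        _ = ∫ ω, (G ω - coordAvg μ {k} G ω) ^ 2 ∂Measure.pi (fun _ : ι => μ) :=
            integral_coordAvg μ s (hHk.pow 2)
    linarith

/-- **The Efron–Stein inequality**: for `π = ⊗_{i∈ι} μ` a finite product of copies of a Borel
probability measure on a compact metric space and `G` continuous,
`Var_π(G) = ∫ (G − ∫G dπ)² dπ ≤ Σ_k ∫ (G − A_k G)² dπ`, `A_k G(ω) = ∫ G(ω[k ← v]) dμ(v)`. -/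
theorem efronStein {G : (ι → X) → ℝ} (hG : Continuous G) :
    ∫ ω, (G ω - ∫ ω', G ω' ∂Measure.pi (fun _ : ι => μ)) ^ 2 ∂Measure.pi (fun _ : ι => μ) ≤
      ∑ k, ∫ ω, (G ω - coordAvg μ {k} G ω) ^ 2 ∂Measure.pi (fun _ : ι => μ) := by
  have h := integral_sq_sub_coordAvg_le μ Finset.univ hG
  simp_rw [coordAvg_univ] at h
  exact h

/-- **`E[(G − A_k G)²]` is the mean conditional variance in coordinate `k`**:
`∫ (G − A_k G)² dπ = ∫ (∫ G(ω[k←v])² dμ(v) − (∫ G(ω[k←v]) dμ(v))²) dπ(ω)`. -/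
theorem integral_sq_sub_coordAvg_singleton (k : ι) {G : (ι → X) → ℝ} (hG : Continuous G) :
    ∫ ω, (G ω - coordAvg μ {k} G ω) ^ 2 ∂Measure.pi (fun _ : ι => μ) =
      ∫ ω, (∫ v, G (update ω k v) ^ 2 ∂μ - (∫ v, G (update ω k v) ∂μ) ^ 2)
        ∂Measure.pi (fun _ : ι => μ) := by
  have huniv : (fun _ : ι => μ) k Set.univ ≠ 0 := by simp
  have hAk : Continuous (coordAvg μ {k} G) := continuous_coordAvg μ {k} hG
  have hH : Continuous fun ω => (G ω - coordAvg μ {k} G ω) ^ 2 := (hG.sub hAk).pow 2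
  have hL := integral_pi_eq_integral_integral_update' (fun _ : ι => μ) k huniv
    (integrable_pi_of_continuous μ hH)
  simp only [measure_univ, inv_one, ENNReal.toReal_one, one_smul] at hL
  rw [hL]
  refine integral_congr_ae (ae_of_all _ fun ω => ?_)
  simp only
  -- in the fibre: `A_k G(ω[k ← v]) = A_k G(ω) = ∫ G(ω[k ← w]) dμ(w)`
  have hinv : ∀ v, coordAvg μ {k} G (update ω k v) = ∫ w, G (update ω k w) ∂μ := by
    intro v
    rw [coordAvg_singleton μ k hG]
    simp only [update_idem]
  simp_rw [hinv]
  set c := ∫ w, G (update ω k w) ∂μ with hc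
  have hcu : Continuous fun v : X => G (update ω k v) := hG.comp (continuous_update_right ω k)
  have hi : Integrable (fun v => G (update ω k v)) μ :=
    hcu.integrable_of_hasCompactSupport (HasCompactSupport.of_compactSpace _)
  have hi2 : Integrable (fun v => G (update ω k v) ^ 2) μ :=
    (hcu.pow 2).integrable_of_hasCompactSupport (HasCompactSupport.of_compactSpace _)
  have hB : Integrable (fun v => 2 * c * G (update ω k v)) μ := hi.const_mul _
  have hA : Integrable (fun v => G (update ω k v) ^ 2 - 2 * c * G (update ω k v)) μ := hi2.sub hB
  have hfun : (fun v => (G (update ω k v) - c) ^ 2) =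
      fun v => G (update ω k v) ^ 2 - 2 * c * G (update ω k v) + c ^ 2 := by
    funext v; ring
  rw [hfun, integral_add hA (integrable_const _), integral_sub hi2 hB, integral_const_mul,
    integral_const, smul_eq_mul, Measure.real, measure_univ, ENNReal.toReal_one, one_mul, ← hc]
  ring

end EfronStein

end Summit.Ventures.LatticeQCDFlow.Exactness

end
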